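import Mathlib
import Literature.AlgebraicGeometry.Resolution.NormalCrossingsLocal
import Literature.AlgebraicGeometry.RelativeSpec.FreeQuotient
import Summits.ResolutionOfSingularities.ResolutionOfSingularities.Theorems.WildQuotientsWildQuotientResolutionGluedQuotientPieces
import Summits.ResolutionOfSingularities.ResolutionOfSingularities.Theorems.WildQuotientsWildQuotientResolutionBlowupLocalExitAffine
import Summits.ResolutionOfSingularities.ResolutionOfSingularities.Theorems.WildQuotientsWildQuotientResolutionBlowupLocalExitCharts

/-!
# The cone-brick transfer: a regular blow-up of a quotient piece from a presentation of its invariant ring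
(crux stmt-ResolutionOfSingularities-15640 `WildQuotients.WildQuotientResolution`, line `Sketch`;
chain w45c programmes V3U/V4U, RULING v6.3 (2) «generic cone-brick transfer = lead-1»;
[OURS · L1 W4.5c] — generic glue, NOT a statement of any manuscript.)

For an action `ρ` of a finite group `G` on `X → S` over an AFFINE base and a `G`-stable open `O`
affine over `S`, the quotient piece is `O/G ≅ Spec Γ(O)^G` (`BlowupExit.exists_iso_spec_pieceQuot`,
p486067). The cone bricks of the toric exits (V3U `HPa`, V4U `HP₀`/`HP₁`) ask: for the closed
image `Z = q(T)` of a closed `T ⊆ O` under `q : O → O/G`, SOME blow-up of `O/G` along `𝓘_Z` is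
regular. `BlowupExit.exists_isBlowup_regular_of_invariantsPresentation` reduces this to RING data:

* a PRESENTATION `ψ : R →+* Γ(O)` of the invariant ring (injective, `range ψ = Γ(O)^G`);
* EQUATIONS `𝔞 ⊆ Γ(O)` of `T` upstairs (`T = zeroLocus 𝔞`);
* a radical ideal `J₀ ⊆ R` with `√(ψ⁻¹(𝔞 Γ(O))) = J₀` (the vertex ideal downstairs) whose affine
  blow-up `Bl_{J₀}(Spec R)` is regular (the cone charts: V3U C4, V4U C4⅓/C4½).

Proof: `Γ(O)` is integral over `Γ(O)^G` (Mathlib `Algebra.IsInvariant.isIntegral`), so the image of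
`V(𝔞)` in `Spec Γ(O)^G` is `V(𝔞 ∩ Γ(O)^G)` (lying over, `image_comap_zeroLocus_eq_of_isIntegral`);
transporting along `R ≅ Γ(O)^G` and `Spec Γ(O)^G ≅ O/G` identifies `𝓘_Z` with the ideal sheaf of
`J₀` (`vanishingIdeal_eq_idealSheaf_of_isRadical`, p485627), and `exists_isBlowup_regular_of_iso_spec`
(p489276) concludes.
-/

-- single-problem summit: the doubled namespace component `ResolutionOfSingularities` is forced
set_option linter.dupNamespace false

noncomputable section

open CategoryTheory AlgebraicGeometry TopologicalSpace
open Literature.AlgebraicGeometry.Resolution Literature.AlgebraicGeometry.RelativeSpec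

namespace Summit.ResolutionOfSingularities.ResolutionOfSingularities.Theorems.WildQuotientResolution.BlowupExit

/-- **Lying over, set form**: for an integral extension `A → B` the image of `V(I) ⊆ Spec B` in
`Spec A` is `V(I ∩ A)`. [folklore] -/
theorem image_comap_zeroLocus_eq_of_isIntegral {A B : Type*} [CommRing A] [CommRing B]
    [Algebra A B] [Algebra.IsIntegral A B] (I : Ideal B) :
    PrimeSpectrum.comap (algebraMap A B) '' PrimeSpectrum.zeroLocus (I : Set B) =
      PrimeSpectrum.zeroLocus ((I.comap (algebraMap A B) : Ideal A) : Set A) := by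
  ext P
  simp only [Set.mem_image, PrimeSpectrum.mem_zeroLocus, SetLike.coe_subset_coe]
  constructor
  · rintro ⟨Q, hQ, rfl⟩
    exact Ideal.comap_mono hQ
  · intro hP
    obtain ⟨Q, hQI, hQp, hQP⟩ := Ideal.exists_ideal_over_prime_of_isIntegral P.asIdeal I hP
    exact ⟨⟨Q, hQp⟩, hQI, PrimeSpectrum.ext hQP⟩

/-- Preimages of closed sets `V(s)` under `Spec f` are `V(f(s))`. [folklore] -/
theorem preimage_specMap_base_zeroLocus {A B : Type} [CommRing A] [CommRing B] (f : A →+* B)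
    (s : Set A) :
    (Spec.map (CommRingCat.ofHom f)).base ⁻¹' PrimeSpectrum.zeroLocus s =
      PrimeSpectrum.zeroLocus (f '' s) := by
  ext x
  change s ⊆ ((PrimeSpectrum.comap f x).asIdeal : Set A) ↔ (f : A → B) '' s ⊆ (x.asIdeal : Set B)
  rw [PrimeSpectrum.comap_asIdeal, Ideal.coe_comap]
  exact Set.image_subset_iff.symm

/-- **The cone-brick transfer.** Let `O` be a `G`-stable open, affine over the affine base `S`,
`ψ : R → Γ(O)` an injective ring map onto the invariants `Γ(O)^G`, `𝔞 ⊆ Γ(O)`, and `J₀ ⊆ R` a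
radical ideal with `√(ψ⁻¹(𝔞)) = J₀` whose affine blow-up is regular. If the closed `Z ⊆ O/G` is the
image of `V(𝔞) ⊆ O`, then some blow-up of `O/G` along `𝓘_Z` is regular. [OURS · L1 W4.5c]
[folklore; assembly of landed decls] -/
theorem exists_isBlowup_regular_of_invariantsPresentation {X S : Scheme.{0}} {r : X ⟶ S}
    {G : Type} [Group G] [Finite G] (ρ : ActionOver r G) [S.IsSeparated] [IsSeparated r]
    [IsAffine S] (O : ρ.StableAffineOpens) {R : Type} [CommRing R]
    (ψ : R →+* Γ((O.1 : Scheme.{0}), (O.1.ι ≫ r) ⁻¹ᵁ ⊤)) (hψ : Function.Injective ψ)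
    (hrange : ψ.range = (ρ.restrict O.1 O.2.1).invariantsRing ⊤)
    (𝔞 : Set Γ((O.1 : Scheme.{0}), (O.1.ι ≫ r) ⁻¹ᵁ ⊤)) (J₀ : Ideal R) (hJ₀ : J₀.IsRadical)
    (hJ : ((Ideal.span 𝔞).comap ψ).radical = J₀)
    (hreg : Scheme.IsRegular (affineBlowup J₀))
    (Z : Closeds (ρ.pieceQuot O))
    (hZ : (Z : Set (ρ.pieceQuot O)) = (ρ.pieceMk O).base '' ((O.1 : Scheme.{0}).zeroLocus 𝔞)) :
    ∃ (B : Scheme.{0}) (pB : B ⟶ ρ.pieceQuot O),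
      IsBlowup pB (Scheme.IdealSheafData.vanishingIdeal Z) ∧ Scheme.IsRegular B := by
  classical
  -- the action on `Γ(O)` and the invariance structure `Γ(O)^G ⊆ Γ(O)`
  letI := (ρ.restrict O.1 O.2.1).mulSemiringAction ⊤
  haveI := (ρ.restrict O.1 O.2.1).isInvariant_invariantsRing ⊤
  -- notation
  let XO : Scheme.{0} := (O.1 : Scheme.{0})
  let U' : XO.Opens := (O.1.ι ≫ r) ⁻¹ᵁ ⊤
  let Γ_O : Type := Γ(XO, U')
  let Inv : Subring Γ_O := (ρ.restrict O.1 O.2.1).invariantsRing ⊤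
  -- `O` is affine, `U' = ⊤` is an affine open and `U'.toSpecΓ` is an isomorphism
  haveI : IsAffineHom (O.1.ι ≫ r) := O.2.2
  haveI : IsAffine XO := isAffine_of_isAffineHom (O.1.ι ≫ r)
  have hU'top : U' = ⊤ := Scheme.Hom.preimage_top _
  have hU'aff : IsAffineOpen U' := by rw [hU'top]; exact isAffineOpen_top XO
  -- the quotient piece is the spectrum of the invariants
  obtain ⟨e, he⟩ := exists_iso_spec_pieceQuot ρ O
  -- `R ≅ Γ(O)^G`
  have hmem : ∀ x : R, ψ x ∈ Inv := fun x => by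
    change ψ x ∈ ((ρ.restrict O.1 O.2.1).invariantsRing ⊤ : Subring Γ_O)
    rw [← hrange]; exact ⟨x, rfl⟩
  let ψ₀ : R →+* Inv := ψ.codRestrict Inv hmem
  have hψ₀ : Function.Bijective ψ₀ := by
    refine ⟨fun x y hxy => hψ (congrArg Subtype.val hxy :), fun y => ?_⟩
    have hy : (y : Γ_O) ∈ ψ.range := by rw [hrange]; exact y.2
    obtain ⟨x, hx⟩ := hy
    exact ⟨x, Subtype.ext hx⟩
  let ψ' : R ≃+* Inv := RingEquiv.ofBijective ψ₀ hψ₀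
  have hψ' : ∀ x : R, ((ψ' x : Inv) : Γ_O) = ψ x := fun x => rfl
  -- `Γ(O)` is integral over the invariants
  haveI : Algebra.IsIntegral Inv Γ_O :=
    Algebra.IsInvariant.isIntegral ((ρ.restrict O.1 O.2.1).invariantsRing ⊤)
      Γ((O.1 : Scheme.{0}), (O.1.ι ≫ r) ⁻¹ᵁ ⊤) G
  -- the isomorphism `E : Spec R ≅ O/G`
  let sR : Spec (CommRingCat.of R) ⟶ Spec (CommRingCat.of Inv) :=
    Spec.map (CommRingCat.ofHom (ψ'.symm : Inv →+* R))
  haveI : IsIso sR := by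
    have : IsIso (CommRingCat.ofHom (ψ'.symm : Inv →+* R)) :=
      (ψ'.symm.toCommRingCatIso).isIso_hom
    exact inferInstance
  let E : Spec (CommRingCat.of R) ≅ ρ.pieceQuot O := asIso sR ≪≫ e
  -- the preimage of `Z` in `Spec Γ(O)^G` is `V(𝔞 ∩ Γ(O)^G)`
  have hZe : e.hom.base ⁻¹' (Z : Set (ρ.pieceQuot O)) =
      PrimeSpectrum.zeroLocus (((Ideal.span 𝔞).comap (algebraMap Inv Γ_O) : Ideal Inv) : Set Inv) := by
    -- every point of `O` lies in `U'`
    have hsurj : Function.Surjective U'.ι.base := by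
      intro x
      exact ⟨⟨x, by rw [hU'top]; trivial⟩, rfl⟩
    -- `Z = e(Spec(subtype)(toSpecΓ(U'.ι⁻¹ V(𝔞))))`
    have hcomp : ∀ x : (U' : Scheme.{0}), (ρ.pieceMk O).base (U'.ι.base x) =
        e.hom.base ((Spec.map (CommRingCat.ofHom Inv.subtype)).base (U'.toSpecΓ.base x)) := by
      intro x
      have h : (U'.ι ≫ ρ.pieceMk O) x =
          (U'.toSpecΓ ≫ Spec.map (CommRingCat.ofHom Inv.subtype) ≫ e.hom) x := by
        rw [he]
      rw [Scheme.Hom.comp_apply, Scheme.Hom.comp_apply, Scheme.Hom.comp_apply] at h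
      exact h
    have hZ' : (Z : Set (ρ.pieceQuot O)) = e.hom.base ''
        ((Spec.map (CommRingCat.ofHom Inv.subtype)).base ''
          (U'.toSpecΓ.base '' (U'.ι.base ⁻¹' XO.zeroLocus 𝔞))) := by
      rw [hZ, ← Set.image_comp, ← Set.image_comp]
      ext z
      constructor
      · rintro ⟨y, hy, rfl⟩
        obtain ⟨x, rfl⟩ := hsurj y
        exact ⟨x, hy, (hcomp x).symm⟩
      · rintro ⟨x, hx, rfl⟩
        exact ⟨U'.ι.base x, hx, hcomp x⟩
    -- `toSpecΓ(U'.ι⁻¹ V(𝔞)) = V(𝔞) ⊆ Spec Γ(O)`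
    have hT : U'.toSpecΓ.base '' (U'.ι.base ⁻¹' XO.zeroLocus 𝔞) = PrimeSpectrum.zeroLocus 𝔞 := by
      have hpre : U'.toSpecΓ.base ⁻¹' PrimeSpectrum.zeroLocus 𝔞 = U'.ι.base ⁻¹' XO.zeroLocus 𝔞 := by
        rw [Scheme.Opens.toSpecΓ_preimage_zeroLocus]
        rfl
      rw [← hpre]
      refine Set.image_preimage_eq _ fun y => ⟨hU'aff.isoSpec.inv.base y, ?_⟩
      have h : (hU'aff.isoSpec.inv ≫ hU'aff.isoSpec.hom) y = y := by
        rw [Iso.inv_hom_id]; rfl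
      rw [Scheme.Hom.comp_apply, IsAffineOpen.isoSpec_hom] at h
      exact h
    -- lying over
    have himg : (Spec.map (CommRingCat.ofHom Inv.subtype)).base '' PrimeSpectrum.zeroLocus 𝔞 =
        PrimeSpectrum.zeroLocus
          (((Ideal.span 𝔞).comap (algebraMap Inv Γ_O) : Ideal Inv) : Set Inv) := by
      rw [← PrimeSpectrum.zeroLocus_span 𝔞]
      exact image_comap_zeroLocus_eq_of_isIntegral (A := Inv) (B := Γ_O) (Ideal.span 𝔞)
    rw [hZ']
    have hinj : Function.Injective e.hom.base := e.hom.isOpenEmbedding.injective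
    have h2 := congrArg (fun A => (Spec.map (CommRingCat.ofHom Inv.subtype)).base '' A) hT
    exact (Set.preimage_image_eq _ hinj).trans (h2.trans himg)
  -- `ψ'⁻¹(𝔞 Γ(O) ∩ Γ(O)^G) = ψ⁻¹(𝔞 Γ(O))`
  have hideal : Ideal.span ((ψ'.symm : Inv →+* R) ''
      (((Ideal.span 𝔞).comap (algebraMap Inv Γ_O) : Ideal Inv) : Set Inv)) =
      (Ideal.span 𝔞).comap ψ := by
    apply le_antisymm
    · rw [Ideal.span_le]
      rintro _ ⟨y, hy, rfl⟩
      change ψ ((ψ'.symm : Inv →+* R) y) ∈ Ideal.span 𝔞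
      have : ψ ((ψ'.symm : Inv →+* R) y) = (y : Γ_O) := by
        rw [← hψ', RingEquiv.coe_toRingHom, RingEquiv.apply_symm_apply]
      rw [this]
      exact hy
    · intro x hx
      refine Ideal.subset_span ⟨ψ' x, ?_, ?_⟩
      · change ((ψ' x : Inv) : Γ_O) ∈ Ideal.span 𝔞
        rw [hψ']; exact hx
      · change ψ'.symm (ψ' x) = x
        exact ψ'.symm_apply_apply x
  -- the preimage of `Z` in `Spec R` is `V(J₀)`
  have hZE : ((Z.preimage E.hom.continuous : Closeds (Spec (CommRingCat.of R))) :
      Set (Spec (CommRingCat.of R))) = PrimeSpectrum.zeroLocus (J₀ : Set R) := by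
    rw [Closeds.coe_preimage]
    change (sR ≫ e.hom).base ⁻¹' (Z : Set (ρ.pieceQuot O)) = _
    rw [Scheme.Hom.comp_base, TopCat.coe_comp, Set.preimage_comp]
    refine (congrArg (fun A => sR.base ⁻¹' A) hZe).trans ?_
    refine (preimage_specMap_base_zeroLocus (ψ'.symm : Inv →+* R) _).trans ?_
    rw [← PrimeSpectrum.zeroLocus_span, hideal, ← hJ, PrimeSpectrum.zeroLocus_radical]
  -- hence `𝓘_Z` pulls back to the ideal sheaf of `J₀`, whose blow-up is regular
  have h𝓘 : (Scheme.IdealSheafData.vanishingIdeal Z).comap E.hom = affineBlowup.idealSheaf J₀ := by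
    rw [comap_vanishingIdeal_of_isOpenImmersion]
    exact vanishingIdeal_eq_idealSheaf_of_isRadical J₀ hJ₀ _ hZE
  exact exists_isBlowup_regular_of_iso_spec E _ J₀ h𝓘 hreg

end Summit.ResolutionOfSingularities.ResolutionOfSingularities.Theorems.WildQuotientResolution.BlowupExit

end
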